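import Summits.Parity.BatemanHorn.Theses.AlmostPrimeZeros

/-!
# Disproof attempts on `AlmostPrimeZeros.SystemZeroRepulsion` (stmt-Parity-11291) — standing adversary file

Crux (rank 2 of route `AlmostPrimeZeros`): for every Bateman–Horn system `f = (f₁,…,f_k)` there is
`C_f` with `T_f(x) := Σ_ρ |1-ρ|⁻² ≤ C_f` for all `x ≥ 2`, the sum over the roots `ρ` (with
multiplicity) of the almost-prime polynomial `S_x(z) = Σ_{0≤n≤x} z^{s_f(n)}`,
`s_f(n) = Σ_i Σ_{p^v ∥ f_i(n)} min(v,2)` (`f_i(n) ≤ 1` contributes `0`).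

## Findings (cycle 1, 2026-08-15) — details in the docstrings below

1. ELABORATION: rc 0; the functional is `T k f x` below (`systemZeroRepulsion_iff`, `Iff.rfl`).
   Junk audit: `‖1-ρ‖^2)⁻¹` is junk-free (`S_x(1) = x+1 ≠ 0`, so `ρ ≠ 1`); `toNat` sends
   `f_i(n) ≤ 0` to `0` and `Nat.factorization 0 = Nat.factorization 1 = 0`; `n` runs over
   `0..x` (so `S_x(1) = x+1`); a constant `S_x` (all exponents `0`) has `roots = 0`, `T = 0`.
2. NOT A KILL — degenerate instances are harmless: `k = 0` (the empty family IS a Bateman–Horn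
   system, `isBatemanHornSystem_empty`) gives `T ≡ 0` (`T_fin_zero`); sign-degenerate members are
   excluded by `leadingCoeff_pos`; for every FIXED system any finite set of `x` is absorbed in `C_f`,
   so the statement is purely asymptotic (`withoutXGeTwo_iff`: the side condition `2 ≤ x` is not
   load-bearing) and cannot be refuted by a finite computation.
3. LOAD-BEARING ANALYSIS. (a) `2 ≤ x`: not load-bearing (theorem `withoutXGeTwo_iff`). (b) the
   dependence of `C` on `f`: load-bearing — `UniformConstant` is FALSE (THEOREM `not_uniformConstant`,
   section (c): a `k = u` system of quadratics `a_p X(X-1) + p` has `S_2(z) = z^u (2 + z^w)`, `w ≥ u`,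
   and `T_f(2) > u²/21`, `exists_system_T_two_gt`); so `C_f` is at least quadratic in `k` on some
   systems. (c) the Bateman–Horn axioms (`irreducible`,
   `pairwise_not_associated`, `hasNoFixedPrimeDivisor`): NO evidence they are load-bearing for THIS
   crux (they are for `ExtractionAtZero`): every degenerate non-system tried (`(X,…,X)`: `S_x(z) =
   P_x(z^k)`; `X^j`: `P^ω_x(z²)`; constants: `T = s(c)`; fixed prime/square divisors: `T` shifts by
   an integer) stays bounded iff the corresponding honest instance does — a proof of rank 2 will not
   "use" the system axioms except through the local factors of the LSD law. (d) the cap `min v 2`: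
   load-bearing by the planner's own numerics (`Ω`: `T ≍ log x`, zeros on `|z| = 2` from the
   geometric tail `c_j ≍ x 2^{-j}`); with the cap the tail `c_j = #{n ≤ x : s_f(n) = j}` is
   super-geometrically thin for EVERY tuple `f` (reaching `s = j` needs `≥ j/2` distinct primes), so
   no bounded zero circle can come from the tail in any system.
4. WHERE IT COULD FAIL / WHY IT RESISTS — four concentric regimes around `z = 1` (`L := log log x`):
   (iv) FAR, `|1-ρ| ≥ K·L`: FREE for `f = X`/linear systems, ANATOMY (parity-free) in general. Jensen at
   centre `1` needs only an UPPER bound for the circle mean of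
   `log|S_x|`, and `max_{|z-1|=r}|S_x(z)| = S_x(1+r)` (positive coefficients); the POSITIVE-MOMENT bound
   (M) `log(S_x(1+y)/(x+1)) ≤ C_f (1+y) L + O_f(y log y)` for `0 ≤ y ≤ √log x` then yields
   `N₁(r) := #{ρ : |1-ρ| ≤ r} ≤ Λ(er) ≤ C_f (1 + e r) L + O(r log r)` for `er ≤ √log x`, and
   `N₁ ≤ deg S_x ≪_f log x/log log x` beyond; so `Σ_{|1-ρ| > KL} |1-ρ|⁻² ≤ 2∫_{KL}^∞ N₁(t) t⁻³ dt
   ≤ C_f L((KL)⁻² + 2e(KL)⁻¹) + 2e² deg S_x/log x + o(1) ≤ 6C_f/K + o(1)`. STATUS OF (M): for `f = X`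
   and linear systems it is ELEMENTARY, unconditional and valid for ALL `y ≥ 0` with `C_f = k`
   (`Σ_{n≤x}(1+y)^{s(n)} ≤ x ∏_{p≤x}(1 + y/p + (y+y²)/p²)` because `d ∣ n ≤ x` forces `d ≤ x`;
   `Σ_{p>y}(y+y²)/p² ≪ y/log y`, `Σ_{p<y} 2 log(1+y/p) ≪ y` — NO `y²` term). For `Σ deg f_i ≥ 2` it is
   NOT elementary — v4 of this file claimed "fundamental lemma + Rankin" and that claim is WITHDRAWN:
   the `+1` in `#{n ≤ x : m ∣ F(n)} ≤ ρ(m)(x/m+1)` is fatal for kernels `m > x`, and Rankin on the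
   `x^{1/L}`-smooth capped kernel `> √x` saves `e^{-cL log L}` only through a Nair–Tenenbaum-type block
   decomposition whose large-deviation step must beat the weight `(1+y)^{#primes} = e^{O(L log y)}` —
   borderline exactly at `y ≍ L`. So for `deg ≥ 2`, (iv) rests on a parity-free ANATOMY statement,
   stub S1 `stub_farMoment` of line smooth-rough-lattice-acquisition (Nair–Tenenbaum/Henriot with the
   `A = 1+y` dependence made explicit; `≤ e^{O(A log A)}(log x)^{C_f A}` is what is needed; plausible,
   unverified here). Either way the card's fear ("far-zero counts out to `r ≍ √deg`, LSD uniform in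
   `|z| ≤ (log x)^{1/2+ε}`") came from an `e^{O(y²)}` that is provably spurious for `f = X` and
   conjecturally spurious in general; granted (M), the crux is EQUIVALENT to boundedness of
   `Σ_{|1-ρ| ≤ K L} |1-ρ|⁻²`.
   (iii) MIDDLE, `R ≤ |1-ρ| ≤ K·L`: by Jensen again it suffices that the circle means
   `A(r) := avg_θ log|S_x(1+re^{iθ})/(x+1)| = Σ_{|1-ρ|<r} log(r/|1-ρ|)` obey `A(r) ≪ r^{2-η}` for
   `r ≤ eKL`; since the right half of each circle contributes `+r|cos θ|·kL`, this REQUIRES the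
   matching smallness `log|S_x(z)/(x+1)| ≤ k(Re z - 1)L + O(|z-1|^{2-η})` on the LEFT half, i.e. a
   ONE-SIDED LSD-quality bound with uniformity `|z| ≤ eKL` — for `f = X` (rank 5) this is
   Selberg–Delange with `R ≍ log log x`. The tree's vendored fact
   `Literature.NumberTheory.LFunctions.SelbergDelangeTheorem` (MV 2007 Thms 7.17–7.18) has `R` FIXED;
   what rank 5 needs is its `R`-dependence made explicit, and `C(R) = e^{O(R log R)}` SUFFICES (then
   `A(r) ≤ Φ(1+r) = O(r log r)`, `N₁(r) ≪ r log r`, middle mass `≪ (1 + log R)/R`), whereas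
   `C(R) = e^{cR²}` would NOT (at `R ≍ L` it swamps the `(log x)^{-1}` saving). CHECKED against the
   printed proof (MV 2007 pp. 177–179, read 2026-08-16): every `≪_R` there is `≤ e^{O(R log R)}` for
   `R ≤ c√(log x)/log log x` — truncation (7.57): `D_R` short-interval count and `ζ(a)^R ≤ (C log x)^R`
   against `T⁻¹ = e^{-√log x}`; contour `C₁, C₃`: `|ζ(s)^z| ≤ (C log T)^R`; on `C₂`:
   `ζ(s)^z/s = (s-1)^{-z}(1 + O(R|s-1|))` and `|(s-1)^{-z}| ≤ |s-1|^{-Re z} e^{π|Im z|}` (the `e^{πR}`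
   MV absorb in `≪_R`), the linear portions give `∫₀^∞ (u²+1)^{(R-1)/2}e^{-u}du ≤ eΓ(R)`; the Hankel
   completion `∫_{H₁∪H₃} ≪ e^{πR}β^R e^{-β}`, `β = c√log x`; Thm 7.18 carries `Σ_m |b_z(m)|(log m)^{2R+1}/m`,
   which for the capped statistic (`b_z` on squarefull `m`, `|b_z(p^v)| ≤ (1+R)²(v+1)^{R+1}`, tree
   docstring) is `≤ e^{O(R log R)}`. (No printed source states the `R`-dependence: Tenenbaum 2017
   arXiv:1709.01315 and de la Bretèche–Tenenbaum arXiv:2010.12929 keep "constants depending on A";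
   Tenenbaum's book Thm II.5.2 requested, acq-04280.) Jensen's formula IS in Mathlib
   (`AnalyticOnNhd.circleAverage_log_norm`, `Mathlib/Analysis/Complex/JensenFormula.lean`; cf. the tree's
   `Literature.Analysis.Complex.BacklundArgVariation.card_zeros_re_le_jensen`). Rank 5 therefore looks
   PROVABLE in print-level mathematics: (a) MV 7.17–7.18 re-derived with `e^{O(R log R)}`, (b) Jensen,
   (c) the elementary far bound of (iv), (d) a zero-free disc at `1` from LSD on `|z| ≤ 2` (`λ(1)/Γ(1) = 1`).
   (ii) NEAR, `r₀ ≤ |1-ρ| ≤ R` fixed: LSD on compacts + Hurwitz pins the zeros to the limit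
   configuration; this range contains `z = -1`, where crux + `HadamardBookkeeping` + `SystemMertens`
   give `|Σ_{n≤x} (-1)^{s(f(n))}| ≪_f x (log x)^{-2k}` — a Chowla-type cancellation along polynomial
   values, open even as `o(x)` for `n²+1`: PARITY-COMPLETE for `deg ≥ 2` (consistent with the card),
   hence not refutable from anything in print or in `Literature/Barriers/Parity` (checked: SelbergParity,
   UniformBatemanHorn, SiegelZeroQuadraticPolynomials, FunctionFieldMobiusBias all concern uniformity
   in `f` or Type-I data; `C_f` depending on `f` absorbs each, cf. 3(b)).
   (i) CORE, `|1-ρ| < r₀(f)`: since `F_x(z) := S_x(z)/((x+1)(log x)^{k(z-1)})` has `F_x(1) = 1`, a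
   zero-free disc of FIXED radius follows (Schwarz) from `|F_x| ≤ M` on a fixed disc around `1`, and
   conversely; trivially (`|E z^S| ≤ E|z|^S`) one only gets `|F_x(z)| ≤ M (log x)^{k(|z|-Re z)}`, bounded
   in the shrinking lens `|Im z| ≲ 1/√(kL)` — so even the softest part of the crux needs, at FIXED small
   frequency `τ`, the characteristic-function decay `|E e^{iτ s_f(n)}| ≪ (log x)^{-k(1-cos τ)}`: a
   Halász-type bound for the unimodular multiplicative function `e^{iτ s(·)}` ALONG POLYNOMIAL VALUES.
   It is "pretentious" (no parity: `g(p) = e^{iτ}` is close to `1`), but writing `g = 1 * h`,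
   `h(p) = e^{iτ}-1 =: δ`, the divisors `d ∣ f(n)` with `d > x` cannot be bounded absolutely (loss
   `(log x)^{k|δ|}` against a main term `(log x)^{-k|δ|²/2}`): level-of-distribution-complete beyond
   level `x` for `deg ≥ 2` (the Type-I₂ wall the card cites for rank 3), though parity-free. For
   `f = X`: Selberg–Delange/Halász (known). NOT uniform in `f`: `exists_system_root_near_one` (roots
   within `ε` of `1` at `x = 2` for suitable systems).
5. PREDICTED LIMIT IS FINITE FOR EVERY SYSTEM (no "limit-configuration" kill): the zeros of the
   conjectural limit `λ_f(z)/Γ(z)^k` are `0,-1,-2,…` (mass `Σ 1/(n+1)² < ∞`), the zeros of the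
   finitely many small-prime local factors `E_p` (polynomials of degree `≤ 2k`, `E_p(1) = 1`), and
   for `p ∤ Disc·Res` one conjugate pair per prime with `|1-z_p|² = p²/ω_f(p)` exactly when
   `ω_f(p) < 4` (real pairs at distance `≍ p/ω` otherwise): total mass `≪ Σ_p D²/p² < ∞`.
   So `T_f(∞) < ∞` always; a refutation would have to come from the middle annulus of item 4.
6. NUMERICS (pure-python local run `compute/tzeros_local.py`, evidence `numerics_local.json`; conventions
   reproduce the planner's values at `10³–10⁶` to 4 digits; kit jobs j005127/j005129/j005133 for `10⁸–10⁹`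
   still queued on a saturated farm). `T_f(x)` at `x = 10⁶, 3·10⁶, 10⁷, 3·10⁷, 10⁸, 3·10⁸`:
   `f = X` (deg 9→11): 2.092, 2.128, 2.166, 2.183, 2.208, 2.223 — increments per half-decade
   0.036/0.038/0.017/0.025/0.014, decelerating, below the predicted limit 2.549; deficit `m₁−v` 1.565→1.582
   (pred. 1.62). `(X, X+2)` (deg 14→17, to `10⁸`): 5.603, 5.727, 5.769, 5.848, 5.825 (pred. 6.35); deficit
   2.828→2.875. `X²+1` (to `3·10⁷`): 1.926, 1.969, 1.992, 1.940 — OSCILLATING below 2.11; deficit 1.824→1.855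
   (pred. 1.97). `X²+X+1` (to `3·10⁷`): 1.764, 1.774, 1.763, 1.789; deficit 1.634→1.665. No drift past any
   prediction; the non-hyperbolic excess `T − (m₁−v)` is 0.53–0.64 (X), ≈2.9 (twin: the pair near
   `e^{±iπ/3}`), 0.09–0.15 (X²+1). ZERO STRUCTURE matches the limit configuration `λ_f/Γ^k` term by
   term: for `f = X` at `3·10⁸` the roots are `≈0`, `−0.537±1.184i` (→ `z₂ = −½ ± i√7/2`), `−1.036`
   (→ `−1`, arrived between `10⁵` and `3·10⁵`), `−1.145±1.677i` (→ `z₃ = −1 ± i√5`), `−2.55±1.49i`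
   (transitional), `−4.2, −9.9, −77.5` (far real zeros marching outward); for the twin system at `10⁸`:
   `0, 0`, `0.443±0.867i` (→ `e^{±iπ/3}`, the `E₂ = (1+z³)/2` zeros predicted by the card, `|1−ρ| = 1.03`),
   `−0.68` (→ the DOUBLE limit zero at `−1`: `E₂` and `Γ`), …; for `X²+1`: `0, −0.82, −1.43±0.28i`
   (→ the doubled `−1` of `E₂ = (1+z)/2`), …. FAR ZEROS: `Σ_{|1−ρ|>log log x}|1−ρ|⁻²` stays in
   `[0.09, 0.57]` for all systems and heights, carried by 2–4 real zeros, as item 4(iv) predicts; the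
   slack between the trivial Jensen bound `Λ(r) = log S_x(1+r)/(x+1)` and the actual Jensen sum `A(r)`
   is only 2.5–4 nats at every radius `r ≤ 12` (`f = X`, `3·10⁸`: `A = 0.75, 2.55, 4.36, 7.74, 10.3, 14.1`
   vs `Λ = 5.40, 7.28, 8.86, 11.4, 13.4, 16.6` at `r = 2, 3, 4, 6, 8, 12`) — the zero count is nearly
   saturating the trivial bound, i.e. there is NO room for a hidden cloud of far zeros at these heights.
   Verdict of the numerics: consistent with `T_f(x) ↑ T_f(∞) < ∞` for all four systems; nothing to
   certify against the crux.

Nothing here is a refutation; everything conclusive is a theorem below, prose is docstring only.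
-/

namespace Summit.Parity.BatemanHorn.Cruxes.SystemZeroRepulsion.Disproof

open Polynomial Finset
open Summit.Parity.BatemanHorn.Theses.AlmostPrimeZeros
open Literature.NumberTheory.Sieve

noncomputable section

/-- The zero functional of the crux, `T_f(x) = Σ_ρ |1-ρ|⁻²` over the roots of
`S_x = Σ_{n ≤ x} X^{s_f(n)} ∈ ℂ[X]` (verbatim sub-term of `SystemZeroRepulsion`). -/
def T (k : ℕ) (f : Fin k → ℤ[X]) (x : ℕ) : ℝ :=
  ((∑ n ∈ Finset.range (x + 1), (Polynomial.X : Polynomial ℂ) ^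
      (∑ i, (((f i).eval (n : ℤ)).toNat.factorization.sum fun _ v => min v 2))).roots.map
    (fun ρ : ℂ => (‖(1 : ℂ) - ρ‖ ^ 2)⁻¹)).sum

/-- The crux, restated through `T` (definitional). -/
theorem systemZeroRepulsion_iff :
    SystemZeroRepulsion ↔
      ∀ (k : ℕ) (f : Fin k → ℤ[X]), IsBatemanHornSystem f → ∃ C : ℝ, ∀ x : ℕ, 2 ≤ x → T k f x ≤ C :=
  Iff.rfl

/-- Every term `(‖1-ρ‖²)⁻¹` is non-negative, hence so is `T`. -/
theorem T_nonneg (k : ℕ) (f : Fin k → ℤ[X]) (x : ℕ) : 0 ≤ T k f x := by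
  unfold T
  refine Multiset.sum_nonneg fun t ht => ?_
  obtain ⟨ρ, -, rfl⟩ := Multiset.mem_map.mp ht
  positivity

/-! ## (a) Load-bearing analysis -/

/-- Hypothesis `2 ≤ x` dropped. -/
def WithoutXGeTwo : Prop :=
  ∀ (k : ℕ) (f : Fin k → ℤ[X]), IsBatemanHornSystem f → ∃ C : ℝ, ∀ x : ℕ, T k f x ≤ C

/-- `2 ≤ x` is NOT load-bearing: for a fixed system the finitely many small `x` are absorbed in
the constant. (So any refutation must be asymptotic in `x`; no finite computation can kill the
crux.) -/
theorem withoutXGeTwo_iff : WithoutXGeTwo ↔ SystemZeroRepulsion := by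
  constructor
  · intro h k f hf
    obtain ⟨C, hC⟩ := h k f hf
    exact ⟨C, fun x _ => hC x⟩
  · intro h k f hf
    obtain ⟨C, hC⟩ := h k f hf
    refine ⟨max C (max (T k f 0) (T k f 1)), fun x => ?_⟩
    rcases Nat.lt_or_ge x 2 with hx | hx
    · interval_cases x
      · exact (le_max_left _ _).trans (le_max_right _ _)
      · exact (le_max_right _ _).trans (le_max_right _ _)
    · exact (hC x hx).trans (le_max_left _ _)

/-- The Bateman–Horn axioms dropped entirely (all tuples of integer polynomials). STATUS: open —
no witness found. Every degenerate tuple tried reduces to an honest instance: `(X,…,X)` (k copies,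
excluded only by `pairwise_not_associated`) has `S_x(z) = P_x(z^k)` with `P_x` the `f = X`
polynomial, and `T` stays bounded iff `P_x`'s zero statistic does (k-th roots of zeros tending to
`0` contribute `k`, of zeros near `-1` contribute `Σ_ζ |1-ζ|⁻²` over `ζ^k = -1`, finite);
`X^j` (`j ≥ 2`, reducible) gives `s = 2ω(n)`, `S_x = P^ω_x(z²)`; a constant `c` gives
`S_x = (x+1) z^{s(c)}`, `T = s(c)`; a member with a fixed prime (square) divisor multiplies `S_x`
by a power of `z` (adds an integer to `T`) up to the bounded variation of `min(v,2)`; a member with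
negative leading coefficient contributes `0` for large `n`. So for THIS crux the system axioms
look decorative (they are load-bearing downstream, in `ExtractionAtZero`). -/
def WithoutSystem : Prop :=
  ∀ (k : ℕ) (f : Fin k → ℤ[X]), ∃ C : ℝ, ∀ x : ℕ, 2 ≤ x → T k f x ≤ C

theorem withoutSystem_imp : WithoutSystem → SystemZeroRepulsion :=
  fun h k f _ => h k f

/-- The constant made uniform in the system. -/
def UniformConstant : Prop :=
  ∃ C : ℝ, ∀ (k : ℕ) (f : Fin k → ℤ[X]), IsBatemanHornSystem f → ∀ x : ℕ, 2 ≤ x → T k f x ≤ C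

theorem uniformConstant_imp : UniformConstant → SystemZeroRepulsion :=
  fun ⟨C, hC⟩ k f hf => ⟨C, hC k f hf⟩

/-! ## (b) Degenerate instances -/

/-- The empty family (`k = 0`) satisfies the Bateman–Horn hypotheses of the tree (all four clauses
are vacuous or reduce to `p ∤ 1`). So `SystemZeroRepulsion` quantifies over a trivial instance —
harmless here (`T_fin_zero`), recorded so nobody mistakes `k = 0` for a witness. -/
theorem isBatemanHornSystem_empty (f : Fin 0 → ℤ[X]) : IsBatemanHornSystem f := by
  refine ⟨fun i => i.elim0, fun i => i.elim0, fun i => i.elim0, fun p hp => ?_⟩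
  unfold polyRootCountMod
  have h1 : ¬ ((p : ℤ) ∣ 1) := by
    intro h
    have : (p : ℤ).natAbs ∣ (1 : ℤ).natAbs := Int.natAbs_dvd_natAbs.mpr h
    simp only [Int.natAbs_natCast, Int.natAbs_one, Nat.dvd_one] at this
    exact hp.ne_one this
  simp [h1, hp.pos]

/-- For `k = 0` every exponent is `0`, `S_x = x + 1` is a non-zero constant, `roots = 0` and
`T = 0`: the crux holds trivially on the empty system. -/
theorem T_fin_zero (f : Fin 0 → ℤ[X]) (x : ℕ) : T 0 f x = 0 := by
  unfold T
  simp only [Finset.univ_eq_empty, Finset.sum_empty, pow_zero, Finset.sum_const, Finset.card_range,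
    nsmul_eq_mul, mul_one]
  rw [show ((x + 1 : ℕ) : ℂ[X]) = C ((x + 1 : ℕ) : ℂ) from (map_natCast C (x + 1)).symm,
    Polynomial.roots_C]
  simp

theorem systemZeroRepulsion_fin_zero (f : Fin 0 → ℤ[X]) :
    ∃ C : ℝ, ∀ x : ℕ, 2 ≤ x → T 0 f x ≤ C :=
  ⟨0, fun x _ => (T_fin_zero f x).le⟩


/-! ## (c) A natural strengthening refuted: the constant cannot be uniform in the system

Witness family (k = u members): for a prime `p ≥ 11` put `a_p := (4p) % 9 ∈ [1,8]` and
`f_p := a_p X² - a_p X + p = a_p X(X-1) + p`. Then `f_p(0) = f_p(1) = p` (capped statistic `1`) and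
`f_p(2) = 2a_p + p ≡ 9p ≡ 0 (mod 9)` (capped statistic `≥ 2`). For `u` distinct primes
`p_j ≥ max(11, 2u+1)` the tuple `(f_{p_j})_j` IS a Bateman–Horn system (`system_isBatemanHorn`:
irreducible since primitive with negative discriminant `a² - 4ap`; positive leading coefficient;
pairwise non-associated by the constant terms; no fixed prime divisor: `n = 0` handles `ℓ ∉ {p_j}`,
and for `ℓ = p_i` each `f_{p_j}` has `≤ 2` roots mod `p_i`, `2u < p_i`), and
`S_2(z) = 2z^u + z^{u+w}` with `w ≥ u`, whose root `ρ_w = 2^{1/w} e^{iπ/w}` has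
`|1-ρ_w|² < 21/w²` (`norm_one_sub_rho_sq_lt`). Hence `T_f(2) > u²/21` (`exists_system_T_two_gt`)
and `¬ UniformConstant` (`not_uniformConstant`): any `C_f` is at least quadratic in `k` on this
family. (Sorry-free; axioms `propext, Classical.choice, Quot.sound`.) -/

/-- The explicit root `ρ_w = 2^{1/w} e^{iπ/w}` of `z^w = -2`. -/
def rho (w : ℕ) : ℂ := (((2:ℝ) ^ ((1:ℝ) / w) : ℝ) : ℂ) * Complex.exp (((Real.pi / w : ℝ) : ℂ) * Complex.I)

lemma rpow_two_pow (w : ℕ) (hw : w ≠ 0) : ((2:ℝ) ^ ((1:ℝ) / w)) ^ w = 2 := by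
  rw [← Real.rpow_natCast, ← Real.rpow_mul (by norm_num : (0:ℝ) ≤ 2), one_div,
    inv_mul_cancel₀ (Nat.cast_ne_zero.mpr hw), Real.rpow_one]

lemma rho_pow (w : ℕ) (hw : w ≠ 0) : rho w ^ w = -2 := by
  unfold rho
  rw [mul_pow, ← Complex.ofReal_pow, rpow_two_pow w hw, ← Complex.exp_nat_mul]
  have : (w : ℂ) * (((Real.pi / w : ℝ) : ℂ) * Complex.I) = Real.pi * Complex.I := by
    have hw' : (w : ℂ) ≠ 0 := Nat.cast_ne_zero.mpr hw
    push_cast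
    field_simp
  rw [this, Complex.exp_pi_mul_I]
  push_cast
  ring

lemma norm_one_sub_rho_sq_lt (w : ℕ) (hw : w ≠ 0) : ‖1 - rho w‖ ^ 2 < 21 / (w : ℝ) ^ 2 := by
  set r : ℝ := (2:ℝ) ^ ((1:ℝ) / w) with hr
  set θ : ℝ := Real.pi / w with hθ
  have hw0 : (0 : ℝ) < w := Nat.cast_pos.mpr (Nat.pos_of_ne_zero hw)
  have hr1 : 1 ≤ r := Real.one_le_rpow (by norm_num) (by positivity)
  have hrw : r ^ w = 2 := rpow_two_pow w hw
  have hr2 : r ≤ 1 + 1 / w := by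
    by_contra h
    push Not at h
    have h1 : (1 + 1 / (w : ℝ)) ^ w < r ^ w := pow_lt_pow_left₀ h (by positivity) hw
    have h2 : (1 : ℝ) + w * (1 / w) ≤ (1 + 1 / (w : ℝ)) ^ w :=
      one_add_mul_le_pow (by linarith [show (0:ℝ) ≤ 1 / w by positivity]) w
    have h3 : (w : ℝ) * (1 / w) = 1 := by field_simp
    linarith
  have hnorm : ‖1 - rho w‖ ^ 2 = (1 - r) ^ 2 + 2 * r * (1 - Real.cos θ) := by
    have e : rho w = (r : ℂ) * Complex.exp ((θ : ℂ) * Complex.I) := rfl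
    rw [e, Complex.sq_norm, Complex.normSq_apply]
    simp only [Complex.sub_re, Complex.one_re, Complex.re_ofReal_mul, Complex.exp_ofReal_mul_I_re,
      Complex.sub_im, Complex.one_im, Complex.im_ofReal_mul, Complex.exp_ofReal_mul_I_im]
    nlinarith [Real.sin_sq_add_cos_sq θ]
  have hcos : 1 - Real.cos θ ≤ θ ^ 2 / 2 := by linarith [Real.one_sub_sq_div_two_le_cos (x := θ)]
  have hθ2 : θ ^ 2 = Real.pi ^ 2 / (w : ℝ) ^ 2 := by rw [hθ, div_pow]
  have hpi : Real.pi ^ 2 < 10 := by nlinarith [Real.pi_lt_d2, Real.pi_pos]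
  rw [hnorm]
  have h1 : (1 - r) ^ 2 ≤ 1 / (w : ℝ) ^ 2 := by
    have : 0 ≤ r - 1 := by linarith
    have : r - 1 ≤ 1 / w := by linarith
    calc (1 - r) ^ 2 = (r - 1) ^ 2 := by ring
      _ ≤ (1 / (w : ℝ)) ^ 2 := pow_le_pow_left₀ (by linarith) this 2
      _ = 1 / (w : ℝ) ^ 2 := by rw [div_pow, one_pow]
  have h2 : 2 * r * (1 - Real.cos θ) ≤ 2 * 2 * (θ ^ 2 / 2) := by
    have hw1 : (1 : ℝ) / w ≤ 1 := by
      rw [div_le_one hw0]; exact_mod_cast Nat.pos_of_ne_zero hw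
    have : r ≤ 2 := by linarith
    have hc0 : 0 ≤ 1 - Real.cos θ := by linarith [Real.cos_le_one θ]
    nlinarith
  calc (1 - r) ^ 2 + 2 * r * (1 - Real.cos θ) ≤ 1 / (w : ℝ) ^ 2 + 2 * 2 * (θ ^ 2 / 2) := by linarith
    _ = (1 + 2 * Real.pi ^ 2) / (w : ℝ) ^ 2 := by rw [hθ2]; field_simp
    _ < 21 / (w : ℝ) ^ 2 := by
      apply div_lt_div_of_pos_right _ (by positivity)
      linarith

/-- Lower bound for the zero functional of `2 X^u + X^(u+w)`: the root `ρ_w` alone gives `> w²/21`. -/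
lemma T_lower (u w : ℕ) (hw : w ≠ 0) :
    (w : ℝ) ^ 2 / 21 <
      ((((X : ℂ[X]) ^ u + X ^ u + X ^ (u + w)).roots.map (fun ρ : ℂ => (‖(1 : ℂ) - ρ‖ ^ 2)⁻¹)).sum) := by
  set P : ℂ[X] := X ^ u + X ^ u + X ^ (u + w) with hP
  have hP0 : P ≠ 0 := by
    intro h
    have : P.eval 1 = 0 := by rw [h, eval_zero]
    simp [hP] at this
    norm_num at this
  have hroot : rho w ∈ P.roots := by
    rw [mem_roots hP0, IsRoot.def, hP]
    simp only [eval_add, eval_pow, eval_X]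
    rw [pow_add, rho_pow w hw]
    ring
  have hmem : (‖(1 : ℂ) - rho w‖ ^ 2)⁻¹ ∈ P.roots.map (fun ρ : ℂ => (‖(1 : ℂ) - ρ‖ ^ 2)⁻¹) :=
    Multiset.mem_map.mpr ⟨rho w, hroot, rfl⟩
  have hle : (‖(1 : ℂ) - rho w‖ ^ 2)⁻¹ ≤ (P.roots.map (fun ρ : ℂ => (‖(1 : ℂ) - ρ‖ ^ 2)⁻¹)).sum := by
    refine Multiset.single_le_sum (fun t ht => ?_) _ hmem
    obtain ⟨ρ, -, rfl⟩ := Multiset.mem_map.mp ht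
    positivity
  refine lt_of_lt_of_le ?_ hle
  have hw0 : (0 : ℝ) < w := Nat.cast_pos.mpr (Nat.pos_of_ne_zero hw)
  have hpos : 0 < ‖(1 : ℂ) - rho w‖ ^ 2 := by
    have h1 : (1 : ℂ) - rho w ≠ 0 := by
      intro h
      have h' : rho w = 1 := by linear_combination -h
      have := rho_pow w hw
      rw [h', one_pow] at this
      norm_num at this
    positivity
  rw [lt_inv_comm₀ (by positivity) hpos]
  calc ‖(1:ℂ) - rho w‖ ^ 2 < 21 / (w:ℝ) ^ 2 := norm_one_sub_rho_sq_lt w hw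
    _ = ((w : ℝ) ^ 2 / 21)⁻¹ := by rw [inv_div]


/-! ### The witness family `f_p = a_p X² - a_p X + p`, `a_p = (4p) % 9` -/

/-- `a_p = (4p) % 9`, so that `9 ∣ 2 a_p + p`; `1 ≤ a_p ≤ 8` for `p ≠ 3` prime. -/
def aOf (p : ℕ) : ℕ := (4 * p) % 9

/-- The quadratic `a_p X² - a_p X + p` (`= a_p X(X-1) + p`): values `p, p, 2a_p + p` at `0, 1, 2`. -/
def fp (p : ℕ) : ℤ[X] := C (aOf p : ℤ) * X ^ 2 + C (-(aOf p : ℤ)) * X + C (p : ℤ)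

lemma aOf_pos (p : ℕ) (hp : p.Prime) (hp3 : p ≠ 3) : 1 ≤ aOf p := by
  unfold aOf
  have h3 : ¬ 3 ∣ p := fun h => hp3 ((Nat.prime_dvd_prime_iff_eq Nat.prime_three hp).mp h).symm
  omega

lemma aOf_le (p : ℕ) : aOf p ≤ 8 := by unfold aOf; omega

lemma nine_dvd (p : ℕ) : 9 ∣ 2 * aOf p + p := by unfold aOf; omega

lemma fp_eval (p : ℕ) (n : ℤ) : (fp p).eval n = (aOf p : ℤ) * n ^ 2 - (aOf p : ℤ) * n + p := by
  simp [fp]; ring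

lemma fp_eval_zero (p : ℕ) : ((fp p).eval 0).toNat = p := by simp [fp_eval]
lemma fp_eval_one (p : ℕ) : ((fp p).eval 1).toNat = p := by simp [fp_eval]
lemma fp_eval_two (p : ℕ) : ((fp p).eval 2).toNat = 2 * aOf p + p := by
  rw [fp_eval]
  have : (aOf p : ℤ) * (2:ℤ) ^ 2 - (aOf p : ℤ) * 2 + (p : ℤ) = ((2 * aOf p + p : ℕ) : ℤ) := by push_cast; ring
  rw [this, Int.toNat_natCast]

lemma fp_coeff_zero (p : ℕ) : (fp p).coeff 0 = p := by simp [fp]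
lemma fp_coeff_two (p : ℕ) : (fp p).coeff 2 = aOf p := by simp [fp]

/-- The capped statistic `s(m) = Σ_{p^v ∥ m} min(v,2)` (verbatim sub-term of the crux). -/
def sOf (m : ℕ) : ℕ := m.factorization.sum fun _ v => min v 2

lemma sOf_prime (p : ℕ) (hp : p.Prime) : sOf p = 1 := by
  unfold sOf
  rw [Nat.Prime.factorization hp, Finsupp.sum_single_index] <;> simp

lemma two_le_sOf (m : ℕ) (hm : m ≠ 0) (h9 : 9 ∣ m) : 2 ≤ sOf m := by
  unfold sOf
  rw [Finsupp.sum]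
  have h3m : 3 ∣ m := dvd_trans (by norm_num) h9
  have h3 : 3 ∈ m.factorization.support := by
    rw [Nat.support_factorization, Nat.mem_primeFactors]
    exact ⟨Nat.prime_three, h3m, hm⟩
  have hv : 2 ≤ m.factorization 3 := by
    rw [← Nat.Prime.pow_dvd_iff_le_factorization Nat.prime_three hm]
    norm_num; exact h9
  calc 2 = min (m.factorization 3) 2 := by rw [min_eq_right hv]
    _ ≤ ∑ q ∈ m.factorization.support, min (m.factorization q) 2 :=
        Finset.single_le_sum (f := fun q => min (m.factorization q) 2) (fun q _ => Nat.zero_le _) h3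

/-! ### Bateman–Horn hypotheses for the family -/

lemma fp_isPrimitive (p : ℕ) (hp : p.Prime) (h11 : 11 ≤ p) : (fp p).IsPrimitive := by
  rw [isPrimitive_iff_isUnit_of_C_dvd]
  intro r hr
  rw [C_dvd_iff_dvd_coeff] at hr
  have h0 := hr 0
  have h2 := hr 2
  rw [fp_coeff_zero] at h0
  rw [fp_coeff_two] at h2
  rw [Int.isUnit_iff_natAbs_eq]
  have hrp : r.natAbs ∣ p := by
    have := Int.natAbs_dvd_natAbs.mpr h0
    simpa using this
  rcases (Nat.dvd_prime hp).mp hrp with h | h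
  · exact h
  · exfalso
    have hra : r.natAbs ∣ aOf p := by
      have := Int.natAbs_dvd_natAbs.mpr h2
      simpa using this
    rw [h] at hra
    have hp3 : p ≠ 3 := by omega
    have := Nat.le_of_dvd (aOf_pos p hp hp3) hra
    have := aOf_le p
    omega

lemma fp_map_irreducible (p : ℕ) (hp : p.Prime) (h11 : 11 ≤ p) :
    Irreducible ((fp p).map (algebraMap ℤ ℚ)) := by
  have hp3 : p ≠ 3 := by omega
  have ha1 : (1:ℚ) ≤ aOf p := by exact_mod_cast aOf_pos p hp hp3
  have ha8 : (aOf p : ℚ) ≤ 8 := by exact_mod_cast aOf_le p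
  have hp11 : (11:ℚ) ≤ p := by exact_mod_cast h11
  have ha : (aOf p : ℚ) ≠ 0 := by linarith
  have hmap : (fp p).map (algebraMap ℤ ℚ) = C (aOf p : ℚ) * X ^ 2 + C (-(aOf p : ℚ)) * X + C (p : ℚ) := by
    simp [fp, Polynomial.map_add, Polynomial.map_mul]
  rw [hmap, irreducible_iff_roots_eq_zero_of_degree_le_three]
  · apply Multiset.eq_zero_of_forall_notMem
    intro x hx
    rw [mem_roots', IsRoot.def] at hx
    obtain ⟨-, hx⟩ := hx
    simp only [eval_add, eval_mul, eval_C, eval_pow, eval_X] at hx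
    have hne := quadratic_ne_zero_of_discrim_ne_sq (a := (aOf p : ℚ)) (b := -(aOf p : ℚ)) (c := (p:ℚ)) ?_ x
    · apply hne
      linear_combination hx
    · intro s hs
      rw [discrim] at hs
      nlinarith [sq_nonneg s]
  · rw [natDegree_quadratic ha]
  · rw [natDegree_quadratic ha]; norm_num

lemma fp_irreducible (p : ℕ) (hp : p.Prime) (h11 : 11 ≤ p) : Irreducible (fp p) :=
  ((fp_isPrimitive p hp h11).irreducible_iff_irreducible_map_fraction_map (K := ℚ)).mpr
    (fp_map_irreducible p hp h11)

lemma fp_leadingCoeff_pos (p : ℕ) (hp : p.Prime) (h11 : 11 ≤ p) : 0 < (fp p).leadingCoeff := by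
  have hp3 : p ≠ 3 := by omega
  have ha : (aOf p : ℤ) ≠ 0 := by exact_mod_cast (Nat.one_le_iff_ne_zero.mp (aOf_pos p hp hp3))
  unfold fp
  rw [leadingCoeff_quadratic ha]
  exact_mod_cast aOf_pos p hp hp3

lemma fp_not_associated (p q : ℕ) (hpq : p ≠ q) : ¬ Associated (fp p) (fp q) := by
  rintro ⟨v, hv⟩
  obtain ⟨r, hr, hrv⟩ := Polynomial.isUnit_iff.mp v.isUnit
  have h : (fp p * (v : ℤ[X])).coeff 0 = (fp q).coeff 0 := by rw [hv]
  rw [← hrv, coeff_mul_C, fp_coeff_zero, fp_coeff_zero] at h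
  rcases Int.isUnit_iff.mp hr with h1 | h1 <;> subst h1 <;> omega

lemma card_filter_dvd_le_two (ℓ : ℕ) (hℓ : ℓ.Prime) (g : ℤ[X]) (hg : g.natDegree ≤ 2)
    (h2 : ¬ (ℓ : ℤ) ∣ g.coeff 2) :
    #((range ℓ).filter fun n : ℕ => (ℓ : ℤ) ∣ g.eval (n : ℤ)) ≤ 2 := by
  haveI : NeZero ℓ := ⟨hℓ.ne_zero⟩
  haveI : Fact ℓ.Prime := ⟨hℓ⟩
  set gb := g.map (Int.castRingHom (ZMod ℓ)) with hgb
  have hgb0 : gb ≠ 0 := by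
    intro h
    have : gb.coeff 2 = 0 := by rw [h, coeff_zero]
    rw [hgb, coeff_map, Int.coe_castRingHom, ZMod.intCast_zmod_eq_zero_iff_dvd] at this
    exact h2 this
  have hdeg : gb.natDegree ≤ 2 := (natDegree_map_le).trans hg
  calc #((range ℓ).filter fun n : ℕ => (ℓ : ℤ) ∣ g.eval (n : ℤ)) ≤ #gb.roots.toFinset := by
        refine Finset.card_le_card_of_injOn (fun n : ℕ => (n : ZMod ℓ)) ?_ ?_
        · intro n hn
          rw [Finset.mem_coe, Finset.mem_filter] at hn
          rw [Finset.mem_coe, Multiset.mem_toFinset, mem_roots hgb0, IsRoot.def, hgb]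
          have := eval_intCast_map (Int.castRingHom (ZMod ℓ)) g (n : ℤ)
          rw [Int.cast_natCast] at this
          rw [this, Int.coe_castRingHom, ZMod.intCast_zmod_eq_zero_iff_dvd]
          exact hn.2
        · intro a ha b hb hab
          have ha' := Finset.mem_range.mp (Finset.mem_filter.mp ha).1
          have hb' := Finset.mem_range.mp (Finset.mem_filter.mp hb).1
          have := (ZMod.natCast_eq_natCast_iff' a b ℓ).mp hab
          rwa [Nat.mod_eq_of_lt ha', Nat.mod_eq_of_lt hb'] at this
    _ ≤ Multiset.card gb.roots := Multiset.toFinset_card_le _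
    _ ≤ gb.natDegree := card_roots' gb
    _ ≤ 2 := hdeg

lemma system_isBatemanHorn (u : ℕ) (P : Fin u → ℕ) (hP : ∀ j, (P j).Prime) (h11 : ∀ j, 11 ≤ P j)
    (h2u : ∀ j, 2 * u + 1 ≤ P j) (hinj : Function.Injective P) :
    IsBatemanHornSystem (fun j => fp (P j)) where
  irreducible j := fp_irreducible (P j) (hP j) (h11 j)
  leadingCoeff_pos j := fp_leadingCoeff_pos (P j) (hP j) (h11 j)
  pairwise_not_associated i j hij := fp_not_associated _ _ (fun h => hij (hinj h))
  hasNoFixedPrimeDivisor ℓ hℓ := by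
    unfold polyRootCountMod
    by_cases hmem : ∃ i, P i = ℓ
    · obtain ⟨i, rfl⟩ := hmem
      have hprime : Prime ((P i : ℕ) : ℤ) := Nat.prime_iff_prime_int.mp (hP i)
      calc #((range (P i)).filter fun n : ℕ => ((P i : ℕ) : ℤ) ∣ ∏ j, (fp (P j)).eval (n : ℤ))
          ≤ #(Finset.univ.biUnion fun j : Fin u =>
                (range (P i)).filter fun n : ℕ => ((P i : ℕ) : ℤ) ∣ (fp (P j)).eval (n : ℤ)) := by
            apply Finset.card_le_card
            intro n hn
            rw [Finset.mem_filter] at hn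
            obtain ⟨hn1, hn2⟩ := hn
            obtain ⟨j, -, hj⟩ := (hprime.dvd_finsetProd_iff _).mp hn2
            exact Finset.mem_biUnion.mpr ⟨j, Finset.mem_univ _, Finset.mem_filter.mpr ⟨hn1, hj⟩⟩
        _ ≤ ∑ j, #((range (P i)).filter fun n : ℕ => ((P i : ℕ) : ℤ) ∣ (fp (P j)).eval (n : ℤ)) :=
            Finset.card_biUnion_le
        _ ≤ ∑ _j : Fin u, 2 := by
            refine Finset.sum_le_sum fun j _ => card_filter_dvd_le_two (P i) (hP i) (fp (P j))
              natDegree_quadratic_le ?_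
            rw [fp_coeff_two]
            intro h
            have hp3 : P j ≠ 3 := by have := h11 j; omega
            have h1 := aOf_pos (P j) (hP j) hp3
            have h8 := aOf_le (P j)
            have hle := Int.le_of_dvd (by exact_mod_cast h1) h
            have := h11 i
            omega
        _ = 2 * u := by simp [mul_comm]
        _ < P i := by have := h2u i; omega
    · push Not at hmem
      have h0 : ¬ ((ℓ : ℤ) ∣ ∏ j, (fp (P j)).eval ((0 : ℕ) : ℤ)) := by
        intro h
        have he : ∏ j, (fp (P j)).eval ((0 : ℕ) : ℤ) = ((∏ j, P j : ℕ) : ℤ) := by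
          push_cast
          refine Finset.prod_congr rfl fun j _ => ?_
          simp [fp_eval]
        rw [he, Int.natCast_dvd_natCast] at h
        obtain ⟨j, -, hj⟩ := ((Nat.Prime.prime hℓ).dvd_finsetProd_iff _).mp h
        exact hmem j ((Nat.prime_dvd_prime_iff_eq hℓ (hP j)).mp hj).symm
      have hss : ((range ℓ).filter fun n : ℕ => (ℓ : ℤ) ∣ ∏ j, (fp (P j)).eval (n : ℤ)) ⊂ range ℓ :=
        Finset.filter_ssubset.mpr ⟨0, by simp [hℓ.pos], h0⟩
      calc _ < #(range ℓ) := Finset.card_lt_card hss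
        _ = ℓ := Finset.card_range ℓ


/-- At `x = 2` the almost-prime polynomial of the system `(f_{p_j})` is `X^u + X^u + X^{u+w}` with
`u ≤ w` (exponents `s_f(0) = s_f(1) = u`, `s_f(2) ≥ 2u`). -/
lemma system_poly_two (u : ℕ) (P : Fin u → ℕ) (hP : ∀ j, (P j).Prime) :
    ∃ w : ℕ, u ≤ w ∧
      (∑ n ∈ Finset.range (2 + 1), (Polynomial.X : Polynomial ℂ) ^
        (∑ i, (((fp (P i)).eval (n : ℤ)).toNat.factorization.sum fun _ v => min v 2)))
        = X ^ u + X ^ u + X ^ (u + w) := by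
  set e2 : ℕ := ∑ j, sOf (2 * aOf (P j) + P j) with he2
  have he2ge : 2 * u ≤ e2 := by
    have : ∀ j, 2 ≤ sOf (2 * aOf (P j) + P j) := fun j =>
      two_le_sOf _ (by have := (hP j).pos; omega) (nine_dvd (P j))
    calc 2 * u = ∑ _j : Fin u, 2 := by simp [mul_comm]
      _ ≤ e2 := Finset.sum_le_sum fun j _ => this j
  refine ⟨e2 - u, by omega, ?_⟩
  rw [Nat.add_sub_cancel' (by omega : u ≤ e2)]
  simp only [Finset.sum_range_succ, Finset.sum_range_zero, zero_add, Nat.cast_zero, Nat.cast_one,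
    Nat.cast_ofNat, fp_eval_zero, fp_eval_one, fp_eval_two]
  have h1 : (∑ i : Fin u, (P i).factorization.sum fun _ v => min v 2) = u := by
    have : ∀ i : Fin u, ((P i).factorization.sum fun _ v => min v 2) = 1 := fun i => sOf_prime _ (hP i)
    simp [this]
  rw [h1]
  rfl

lemma T_two_system (u : ℕ) (hu : 1 ≤ u) (P : Fin u → ℕ) (hP : ∀ j, (P j).Prime) :
    (u : ℝ) ^ 2 / 21 < T u (fun j => fp (P j)) 2 := by
  obtain ⟨w, huw, hpoly⟩ := system_poly_two u P hP
  have hw : w ≠ 0 := by omega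
  have key := T_lower u w hw
  unfold T
  rw [hpoly]
  refine lt_of_le_of_lt (div_le_div_of_nonneg_right ?_ (by norm_num)) key
  exact pow_le_pow_left₀ (by positivity) (by exact_mod_cast huw : (u : ℝ) ≤ w) 2

/-- Distinct primes `p_j ≥ max(11, 2u+1)`, `j < u`, packaged (the `(B+j)`-th primes). -/
lemma exists_primes (u : ℕ) : ∃ P : Fin u → ℕ, (∀ j, (P j).Prime) ∧ (∀ j, 11 ≤ P j) ∧
    (∀ j, 2 * u + 1 ≤ P j) ∧ Function.Injective P := by
  set B : ℕ := max 11 (2 * u + 1) with hB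
  have hPge : ∀ j : Fin u, B ≤ Nat.nth Nat.Prime (B + j) := fun j =>
    le_trans (by omega) (Nat.add_two_le_nth_prime (B + j))
  exact ⟨fun j => Nat.nth Nat.Prime (B + j), fun j => Nat.prime_nth_prime _,
    fun j => le_trans (le_max_left _ _) (hPge j), fun j => le_trans (le_max_right _ _) (hPge j),
    fun i j h => Fin.ext (by have := (Nat.nth_strictMono Nat.infinite_setOf_prime).injective h; omega)⟩

/-- No zero-free disc around `1` uniform over systems: for every `ε > 0` some Bateman–Horn system
has, already at `x = 2`, a root of its almost-prime polynomial within `ε` of `1` (the root `ρ_w`,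
`|1-ρ_w|² < 21/w² ≤ 21/u²`, `u > 5/ε`). So the `r₀` of the card's reformulation ("zero-free disc
`|z-1| < r₀` plus `∫ N_x(r) r⁻³ dr ≤ C/2`") must depend on `f` too. -/
theorem exists_system_root_near_one (ε : ℝ) (hε : 0 < ε) :
    ∃ (u : ℕ) (f : Fin u → ℤ[X]), IsBatemanHornSystem f ∧
      ∃ ρ ∈ (∑ n ∈ Finset.range (2 + 1), (Polynomial.X : Polynomial ℂ) ^
        (∑ i, (((f i).eval (n : ℤ)).toNat.factorization.sum fun _ v => min v 2))).roots,
        ‖1 - ρ‖ < ε := by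
  obtain ⟨u, hu⟩ := exists_nat_gt (5 / ε)
  have hu0 : (0 : ℝ) < u := lt_trans (by positivity) hu
  have hu1 : 1 ≤ u := Nat.one_le_iff_ne_zero.mpr (by rintro rfl; simp at hu0)
  obtain ⟨P, hP, h11, h2u, hinj⟩ := exists_primes u
  obtain ⟨w, huw, hpoly⟩ := system_poly_two u P hP
  have hw : w ≠ 0 := by omega
  refine ⟨u, fun j => fp (P j), system_isBatemanHorn u P hP h11 h2u hinj, rho w, ?_, ?_⟩
  · rw [hpoly, mem_roots, IsRoot.def]
    · simp only [eval_add, eval_pow, eval_X]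
      rw [pow_add, rho_pow w hw]; ring
    · intro h
      have : (X ^ u + X ^ u + X ^ (u + w) : ℂ[X]).eval 1 = 0 := by rw [h, eval_zero]
      norm_num at this
  · have h1 : ‖1 - rho w‖ ^ 2 < 21 / (w : ℝ) ^ 2 := norm_one_sub_rho_sq_lt w hw
    have hwu : (u : ℝ) ≤ w := by exact_mod_cast huw
    have h2 : 21 / (w : ℝ) ^ 2 ≤ 21 / (u : ℝ) ^ 2 :=
      div_le_div_of_nonneg_left (by norm_num) (by positivity) (pow_le_pow_left₀ hu0.le hwu 2)
    have h3 : 21 / (u : ℝ) ^ 2 < ε ^ 2 := by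
      rw [div_lt_iff₀ (by positivity)]
      have : 5 < ε * u := by rwa [div_lt_iff₀ hε, mul_comm] at hu
      nlinarith
    have h4 : ‖1 - rho w‖ ^ 2 < ε ^ 2 := by linarith
    exact (abs_lt_of_sq_lt_sq' h4 hε.le).2

theorem not_uniformConstant : ¬ UniformConstant := by
  rintro ⟨C, hC⟩
  obtain ⟨u, hu⟩ := exists_nat_gt (max (21 * C) 1)
  have hu1 : (1 : ℝ) < u := lt_of_le_of_lt (le_max_right _ _) hu
  have huC : 21 * C < u := lt_of_le_of_lt (le_max_left _ _) hu
  obtain ⟨P, hP, h11, h2u, hinj⟩ := exists_primes u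
  have hT := hC u (fun j => fp (P j)) (system_isBatemanHorn u P hP h11 h2u hinj) 2 le_rfl
  have hlow := T_two_system u (by exact_mod_cast hu1.le) P hP
  have hu2 : (u : ℝ) ≤ (u : ℝ) ^ 2 := by nlinarith
  linarith

/-- For every `u ≥ 1` there is a Bateman–Horn system with `u` members whose zero functional at
`x = 2` already exceeds `u²/21`: the constant `C_f` of the crux is at least quadratic in `k` on
this family. -/
theorem exists_system_T_two_gt (u : ℕ) (hu : 1 ≤ u) :
    ∃ f : Fin u → ℤ[X], IsBatemanHornSystem f ∧ (u : ℝ) ^ 2 / 21 < T u f 2 := by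
  obtain ⟨P, hP, h11, h2u, hinj⟩ := exists_primes u
  exact ⟨fun j => fp (P j), system_isBatemanHorn u P hP h11 h2u hinj, T_two_system u hu P hP⟩

end

end Summit.Parity.BatemanHorn.Cruxes.SystemZeroRepulsion.Disproof
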